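import Mathlib
import Literature.NumberTheory.DiophantineGeometry.SchurWeylPlethysmOrbitWeightsProofs
import HarnessLib

/-!
# One-step padding monotonicity FAILS for orbit-closure multiplicities, I: the double-coset
# engine and the vanishing `mult_{(9,3)} ℂ[Δ₄(X₀² X₁²)] = 0`
(crux `ValuativeGCT.ValuativeFlip`, stmt-ValiantsHypothesis-12624; wall-breaker k12 gen 1, axis
"representation-stability transfer between `m` and `m + 1`"; helper file `--supports`)

The axis' standing residual after gen 0 (tree `Cruxes/ValuativeFlip/AxisK12SizeTransfer.md` §Residual,
`DECOMPOSITIONS.md` S4, `DrefuteG2StubPerAnchorInheritance.md` §3) is PADDING MONOTONICITY AT EVERY STEP: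
is `j ↦ mult_{(μ♯(n+j))*} ℂ[Δ_{n+j}(X₀₀^j per_n)]` non-decreasing (BLMW 2011 Problem 6.10 one step at a
time)?  Everything eventual is landed (`eventualInheritance`, `eventualPaddingTransfer`, `det_rayStable`,
`per_rayStable…`); the every-step statement was "open, plausibly true, not implied by anything in the tree".

This file and its companion `…PaddingNonMonotoneSequence.lean` settle the GENERAL form of the every-step
statement in the negative, inside the tree's own definitions (`orbitMultiplicity`, `coordRep`,
`orbitCoordRep`, Borel = upper triangular, padding variable `X₀` = the `B`-eigenvariable as in
`paddedPerFormLex = X₀₀^{m-n} per_n`): along the padding ray `X₀^j · X₁²` in `Sym^{2+j} ℂ²` the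
multiplicity of the row-lifted two-row shapes `(3,3) ↦ (6,3) ↦ (9,3)` (degree `δ = 3`) is `0, ≥ 1, 0`.
So one padding step can DESTROY an isotypic component of an orbit closure, and the general principle
"`mult_χ ℂ[Δ_m(f)] ≤ mult_{χ♯} ℂ[Δ_{m+1}(X₀ f)]` for every form `f`" is false
(`padding_step_monotonicity_fails` in the companion).  (By inheritance, two-row multiplicities do not
depend on the number of ambient variables, so the same happens in `ℂ[Sym^m ℂ^{m²}]`; and
`orbitMultiplicity` only depends on the orbit closure, so the choice of padding variable is immaterial.)

Contents of this part:
* §1 the DOUBLE-COSET ENGINE (general `σ`): a class `[F] ∈ ℂ[Δ_m(f)]` is a `B`-semi-invariant of weight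
  `χ` iff its orbit evaluation `ψ(A) = F(A · f)` on `GL` satisfies `ψ(A) = χ(g) ψ(gA)` for upper
  triangular `g` (`pnm_aeval_formCoeff_eq_weightChar_mul`, `pnm_mk_mem_highestWeightSpace_of_forall`);
  `ψ` is right-invariant under the stabiliser of `f`; `[F] = 0` iff `ψ ≡ 0` on `GL`; so highest-weight
  classes are functions on `B \ GL / Stab(f)` — the classical description of `ℂ[GL/H]^U`, here run INSIDE
  the orbit closure's coordinate ring (Mulmuley–Sohoni 2001 §4–5; BLMW 2011 §4–5; folklore);
* §2 `2 × 2` bookkeeping;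
* §3 `orbitMultiplicity ℂ (X₀² X₁²) 4 (9,3)* = 0`: on the slice `A_r = [[1,0],[r,1]]` the identity
  `[[-1,r⁻¹],[0,1]] · A_r = A_r · [[0,r⁻¹],[r,0]]` (Borel element of character `-1` = stabiliser element)
  forces `ψ(A_r) = -ψ(A_r)`; the torus element `diag(2,1/2)` forces `ψ(1) = 64 ψ(1)`; Bruhat-type case
  split for the rest.  (Classically: `ℂ[Δ(X₀²X₁²)]_3 ⊆ Sym⁶(Sym² ℂ²) = (12) ⊕ (10,2) ⊕ (8,4) ⊕ (6,6)`.)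

Sources: BLMW, SIAM J. Comput. 40 (2011) §6.4 Problem 6.10 (Weyman), §4.4–5.2; Kadish–Landsberg,
Comm. Algebra 42 (2014) §2; Ikenmeyer–Panova, Adv. Math. 319 (2017) Prop. 2.6/13(b);
Bürgisser–Ikenmeyer–Panova, J. AMS 32 (2019) §5; Mulmuley–Sohoni, SIAM J. Comput. 31 (2001) §4–5;
classical invariant theory of binary forms (the cubicovariant).  Numerics behind the choice of example and the
scan of 308 binary padding rays: this seat's `py/binary_padding*.py`, `AXIS.md`.
-/

set_option linter.dupNamespace false

namespace Summit.ValiantsHypothesis.ValiantsHypothesis.Theorems.ValuativeFlip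

open scoped BigOperators Matrix
open MvPolynomial
open Literature.NumberTheory.DiophantineGeometry
open Literature.Computability.AlgebraicComplexity

noncomputable section

/-! ## §1 The double-coset engine -/

/-- **Semi-invariance of orbit evaluations.** If the class of `F` in `ℂ[Δ_m(f)]` is a
`B`-semi-invariant of weight `χ`, then the scalar function `A ↦ F(A · f)` on `GL` satisfies
`F(A · f) = χ(g) · F((g A) · f)` for every upper triangular `g`. [folklore] -/
theorem pnm_aeval_formCoeff_eq_weightChar_mul {σ : Type*} [Fintype σ] [LinearOrder σ]
    (f : MvPolynomial σ ℂ) (m : ℕ) {χ : Weight σ} {F : MvPolynomial (DegIdx σ m) ℂ}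
    (hF : Ideal.Quotient.mk (orbitVanishingIdeal f m) F ∈ highestWeightSpace (orbitCoordRep f m) χ)
    {g : GL σ ℂ} (hg : IsUpperTriangular g) (A : GL σ ℂ) :
    aeval (formCoeff m (linSubst σ ℂ (A : Matrix σ σ ℂ) f)) F =
      weightChar χ g * aeval (formCoeff m (linSubst σ ℂ ((g : Matrix σ σ ℂ) * (A : Matrix σ σ ℂ)) f)) F := by
  have hmem : coordSubst m g F - weightChar χ g • F ∈ orbitVanishingIdeal f m := by
    rw [← Ideal.Quotient.eq]
    have h := hF g hg
    rw [orbitCoordRep_apply, orbitCoordSubst_mk] at h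
    rw [h]
    exact (map_smul (Ideal.Quotient.mkₐ ℂ (orbitVanishingIdeal f m)) (weightChar χ g) F).symm
  have h2 := (mem_orbitVanishingIdeal_iff.mp hmem) (g * A)
  rw [map_sub, map_smul, aeval_formCoeff_coordSubst, sub_eq_zero, smul_eq_mul] at h2
  have h3 : linSubstRep σ ℂ g⁻¹ (linSubstRep σ ℂ (g * A) f) = linSubstRep σ ℂ A f := by
    rw [← Module.End.mul_apply, ← map_mul, inv_mul_cancel_left]
  rw [h3, linSubstRep_apply, linSubstRep_apply, Matrix.GeneralLinearGroup.coe_mul] at h2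
  exact h2

/-- **Converse: semi-invariant orbit evaluations give highest-weight classes.** If
`F(A · f) = χ(g) · F((g A) · f)` for all `A ∈ GL` and all upper triangular `g`, then the class of
`F` in `ℂ[Δ_m(f)]` is a `B`-semi-invariant of weight `χ`. [folklore] -/
theorem pnm_mk_mem_highestWeightSpace_of_forall {σ : Type*} [Fintype σ] [LinearOrder σ]
    (f : MvPolynomial σ ℂ) (m : ℕ) (χ : Weight σ) (F : MvPolynomial (DegIdx σ m) ℂ)
    (h : ∀ g : GL σ ℂ, IsUpperTriangular g → ∀ A : GL σ ℂ,
      aeval (formCoeff m (linSubst σ ℂ (A : Matrix σ σ ℂ) f)) F =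
        weightChar χ g * aeval (formCoeff m (linSubst σ ℂ ((g : Matrix σ σ ℂ) * (A : Matrix σ σ ℂ)) f)) F) :
    Ideal.Quotient.mk (orbitVanishingIdeal f m) F ∈ highestWeightSpace (orbitCoordRep f m) χ := by
  intro g hg
  rw [orbitCoordRep_apply, orbitCoordSubst_mk]
  have hmem : coordSubst m g F - weightChar χ g • F ∈ orbitVanishingIdeal f m := by
    rw [mem_orbitVanishingIdeal_iff]
    intro A
    rw [map_sub, map_smul, aeval_formCoeff_coordSubst, smul_eq_mul, sub_eq_zero]
    have h3 : linSubstRep σ ℂ g⁻¹ (linSubstRep σ ℂ A f) = linSubstRep σ ℂ (g⁻¹ * A) f := by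
      rw [← Module.End.mul_apply, ← map_mul]
    rw [h3, linSubstRep_apply, linSubstRep_apply, h g hg (g⁻¹ * A), Matrix.GeneralLinearGroup.coe_mul,
      ← Matrix.mul_assoc, ← Matrix.GeneralLinearGroup.coe_mul, mul_inv_cancel, Units.val_one, Matrix.one_mul]
  rw [← Ideal.Quotient.mkₐ_eq_mk ℂ, ← map_smul, Ideal.Quotient.mkₐ_eq_mk]
  exact Ideal.Quotient.eq.mpr hmem

/-- If every orbit evaluation `F(A · f)`, `A ∈ GL`, vanishes, the class of `F` in `ℂ[Δ_m(f)]` is zero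
(definition of `I(GL · f)`). [folklore] -/
theorem pnm_mk_eq_zero_of_forall {σ : Type*} [Fintype σ] [LinearOrder σ]
    (f : MvPolynomial σ ℂ) (m : ℕ) {F : MvPolynomial (DegIdx σ m) ℂ}
    (h : ∀ A : GL σ ℂ, aeval (formCoeff m (linSubst σ ℂ (A : Matrix σ σ ℂ) f)) F = 0) :
    (Ideal.Quotient.mk (orbitVanishingIdeal f m) F : OrbitCoordRing f m) = 0 := by
  rw [Ideal.Quotient.eq_zero_iff_mem, mem_orbitVanishingIdeal_iff]
  intro A
  rw [linSubstRep_apply]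
  exact h A

/-- Right translation by a stabiliser element does not change orbit evaluations. [folklore] -/
theorem pnm_linSubst_mul_of_stab {σ : Type*} [Fintype σ] [DecidableEq σ]
    {f : MvPolynomial σ ℂ} (A S : Matrix σ σ ℂ) (hS : linSubst σ ℂ S f = f) :
    linSubst σ ℂ (A * S) f = linSubst σ ℂ A f := by
  rw [linSubst_mul, AlgHom.comp_apply, hS]

/-- A nonzero highest-weight class gives multiplicity at least one (`m ≠ 0`). [folklore] -/
theorem pnm_one_le_orbitMultiplicity {σ : Type*} [Fintype σ] [LinearOrder σ]
    (f : MvPolynomial σ ℂ) {m : ℕ} (hm : m ≠ 0) (χ : Weight σ) {v : OrbitCoordRing f m}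
    (hv : v ∈ highestWeightSpace (orbitCoordRep f m) χ) (hv0 : v ≠ 0) :
    1 ≤ orbitMultiplicity ℂ f m χ := by
  haveI := finiteDimensional_highestWeightSpace_orbitCoordRep_holds (k := ℂ) f hm χ
  unfold orbitMultiplicity hwMultiplicity
  rw [Nat.one_le_iff_ne_zero, Ne, Submodule.finrank_eq_zero]
  intro hbot
  rw [hbot] at hv
  exact hv0 ((Submodule.mem_bot ℂ).mp hv)

/-- A highest-weight space all of whose elements vanish has multiplicity zero. [folklore] -/
theorem pnm_orbitMultiplicity_eq_zero {σ : Type*} [Fintype σ] [LinearOrder σ]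
    (f : MvPolynomial σ ℂ) (m : ℕ) (χ : Weight σ)
    (h : ∀ v ∈ highestWeightSpace (orbitCoordRep f m) χ, v = 0) :
    orbitMultiplicity ℂ f m χ = 0 := by
  unfold orbitMultiplicity hwMultiplicity
  rw [(Submodule.eq_bot_iff _).mpr h, finrank_bot]

/-! ## §2 `2 × 2` bookkeeping -/

/-- Upper triangularity in `GL₂`: the `(1,0)` entry vanishes. [folklore] -/
theorem pnm_isUpperTriangular_of_apply_eq_zero {g : GL (Fin 2) ℂ}
    (h : (g : Matrix (Fin 2) (Fin 2) ℂ) 1 0 = 0) : IsUpperTriangular g := by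
  intro i j hij
  fin_cases i <;> fin_cases j <;> simp at hij ⊢
  exact h

/-- The weight character on `GL₂`: `χ(g) = g₀₀ ^ χ 0 * g₁₁ ^ χ 1`. [folklore] -/
theorem pnm_weightChar_fin_two (χ : Weight (Fin 2)) (g : GL (Fin 2) ℂ) :
    weightChar χ g = (g : Matrix (Fin 2) (Fin 2) ℂ) 0 0 ^ χ 0 * (g : Matrix (Fin 2) (Fin 2) ℂ) 1 1 ^ χ 1 := by
  rw [weightChar, Fin.prod_univ_two]

/-- The linear substitution of a `2 × 2` matrix on `X₀² X₁²`. [folklore] -/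
theorem pnm_linSubst_sq_sq (M : Matrix (Fin 2) (Fin 2) ℂ) :
    linSubst (Fin 2) ℂ M (X 0 ^ 2 * X 1 ^ 2 : MvPolynomial (Fin 2) ℂ) =
      (C (M 0 0) * X 0 + C (M 1 0) * X 1) ^ 2 * (C (M 0 1) * X 0 + C (M 1 1) * X 1) ^ 2 := by
  simp only [map_mul, map_pow, linSubst_X, Fin.sum_univ_two, smul_eq_C_mul]

/-- An anti-diagonal stabiliser of `X₀² X₁²`: `X₀ ↦ v X₁`, `X₁ ↦ u X₀` with `u v = 1`. [folklore] -/
theorem pnm_linSubst_antidiag (u v : ℂ) (huv : u * v = 1) :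
    linSubst (Fin 2) ℂ !![0, u; v, 0] (X 0 ^ 2 * X 1 ^ 2 : MvPolynomial (Fin 2) ℂ) = X 0 ^ 2 * X 1 ^ 2 := by
  rw [pnm_linSubst_sq_sq]
  simp only [Matrix.of_apply, Matrix.cons_val', Matrix.cons_val_zero, Matrix.cons_val_one,
    Matrix.cons_val_fin_one, Matrix.empty_val', map_zero, zero_mul, zero_add, add_zero]
  calc (C v * X 1) ^ 2 * (C u * X 0) ^ 2
      = C ((u * v) ^ 2) * (X 0 ^ 2 * X 1 ^ 2 : MvPolynomial (Fin 2) ℂ) := by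
        simp only [map_pow, map_mul]; ring
    _ = X 0 ^ 2 * X 1 ^ 2 := by rw [huv, one_pow, map_one, one_mul]

/-- A diagonal stabiliser of `X₀² X₁²`: `X₀ ↦ u X₀`, `X₁ ↦ v X₁` with `u v = 1`. [folklore] -/
theorem pnm_linSubst_diag (u v : ℂ) (huv : u * v = 1) :
    linSubst (Fin 2) ℂ !![u, 0; 0, v] (X 0 ^ 2 * X 1 ^ 2 : MvPolynomial (Fin 2) ℂ) = X 0 ^ 2 * X 1 ^ 2 := by
  rw [pnm_linSubst_sq_sq]
  simp only [Matrix.of_apply, Matrix.cons_val', Matrix.cons_val_zero, Matrix.cons_val_one,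
    Matrix.cons_val_fin_one, Matrix.empty_val', map_zero, zero_mul, zero_add, add_zero]
  calc (C u * X 0) ^ 2 * (C v * X 1) ^ 2
      = C ((u * v) ^ 2) * (X 0 ^ 2 * X 1 ^ 2 : MvPolynomial (Fin 2) ℂ) := by
        simp only [map_pow, map_mul]; ring
    _ = X 0 ^ 2 * X 1 ^ 2 := by rw [huv, one_pow, map_one, one_mul]


/-! ## §3 The vanishing: `mult_{(9,3)} ℂ[Δ₄(X₀² X₁²)] = 0` -/

/-- **No `(9,3)`-isotypic component on `Δ(X₀² X₁²)`.** For the doubly padded square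
`X₀² X₁² ∈ Sym⁴ ℂ²` and the weight `(9,3)* = (-3,-9)` (shape `(9,3) ⊢ 12`, degree `δ = 3`):
`orbitMultiplicity ℂ (X₀² X₁²) 4 (9,3)* = 0`.  Proof by the double-coset argument: a
`B`-semi-invariant orbit evaluation `ψ(A) = F(A · X₀²X₁²)` of weight `(-3,-9)` is right-invariant
under the monomial stabiliser `{X₀ ↦ vX₁, X₁ ↦ uX₀, uv = 1} ∪ {diag(u,v), uv = 1}`; on the
unipotent slice `A_r = [[1,0],[r,1]]` the identity `[[-1,r⁻¹],[0,1]] · A_r = A_r · [[0,r⁻¹],[r,0]]`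
forces `ψ(A_r) = -ψ(A_r)`, the torus element `diag(2, 1/2)` forces `ψ(1) = 64 ψ(1)`, and every
`A ∈ GL₂` is `B`-equivalent to `1`, to some `A_r` (`r ≠ 0`) or (after the swap) to an upper
triangular matrix. [this crux; folklore] -/
theorem orbitMultiplicity_sq_sq_nine_three_eq_zero :
    orbitMultiplicity ℂ (X 0 ^ 2 * X 1 ^ 2 : MvPolynomial (Fin 2) ℂ) 4 ![-3, -9] = 0 := by
  set f : MvPolynomial (Fin 2) ℂ := X 0 ^ 2 * X 1 ^ 2 with hf
  set χ : Weight (Fin 2) := ![-3, -9] with hχ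
  refine pnm_orbitMultiplicity_eq_zero f 4 χ fun v hv => ?_
  obtain ⟨F, rfl⟩ := Ideal.Quotient.mk_surjective v
  -- the orbit evaluation `ψ`
  set ψ : Matrix (Fin 2) (Fin 2) ℂ → ℂ := fun M => aeval (formCoeff 4 (linSubst (Fin 2) ℂ M f)) F with hψ
  have key : ∀ g : GL (Fin 2) ℂ, IsUpperTriangular g → ∀ A : GL (Fin 2) ℂ,
      ψ (A : Matrix (Fin 2) (Fin 2) ℂ) = weightChar χ g * ψ ((g : Matrix (Fin 2) (Fin 2) ℂ) * (A : Matrix _ _ ℂ)) :=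
    fun g hg A => pnm_aeval_formCoeff_eq_weightChar_mul f 4 hv hg A
  have stab : ∀ (A S : Matrix (Fin 2) (Fin 2) ℂ), linSubst (Fin 2) ℂ S f = f → ψ (A * S) = ψ A := by
    intro A S hS
    simp only [hψ]
    rw [pnm_linSubst_mul_of_stab A S hS]
  -- Step 1: `ψ 1 = 0` (torus element `diag(2, 1/2)`, both Borel and stabiliser)
  have hdet2 : Matrix.det !![(2 : ℂ), 0; 0, 2⁻¹] ≠ 0 := by
    rw [Matrix.det_fin_two_of]; norm_num
  set t : GL (Fin 2) ℂ := Matrix.GeneralLinearGroup.mkOfDetNeZero _ hdet2 with ht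
  have ht_val : (t : Matrix (Fin 2) (Fin 2) ℂ) = !![(2 : ℂ), 0; 0, 2⁻¹] := by
    rw [ht, Matrix.GeneralLinearGroup.val_mkOfDetNeZero]
  have ht_upper : IsUpperTriangular t :=
    pnm_isUpperTriangular_of_apply_eq_zero (by rw [ht_val]; simp)
  have ht_char : weightChar χ t = 64 := by
    rw [pnm_weightChar_fin_two, ht_val, hχ]
    simp
    norm_num
  have h1 : ψ 1 = 0 := by
    have h := key t ht_upper 1
    rw [Units.val_one, Matrix.mul_one, ht_char, ht_val] at h
    have h' : ψ !![(2 : ℂ), 0; 0, 2⁻¹] = ψ 1 := by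
      rw [← Matrix.one_mul !![(2 : ℂ), 0; 0, 2⁻¹]]
      exact stab 1 _ (pnm_linSubst_diag 2 2⁻¹ (by norm_num))
    rw [h'] at h
    -- h : ψ 1 = 64 * ψ 1
    have : (63 : ℂ) * ψ 1 = 0 := by linear_combination -h
    simpa using this
  -- Step 2: upper triangular `A`: `ψ A = 0`
  have h2 : ∀ A : GL (Fin 2) ℂ, IsUpperTriangular A → ψ (A : Matrix (Fin 2) (Fin 2) ℂ) = 0 := by
    intro A hA
    have h := key A hA 1
    rw [Units.val_one, Matrix.mul_one, h1] at h
    -- h : 0 = weightChar χ A * ψ A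
    exact (mul_eq_zero.mp h.symm).resolve_left (weightChar_ne_zero χ hA)
  -- Step 3: the slice `A_r`, `r ≠ 0`
  have h3 : ∀ r : ℂ, r ≠ 0 → ψ !![1, 0; r, 1] = 0 := by
    intro r hr
    have hdetA : Matrix.det !![(1 : ℂ), 0; r, 1] ≠ 0 := by rw [Matrix.det_fin_two_of]; norm_num
    have hdetb : Matrix.det !![(-1 : ℂ), r⁻¹; 0, 1] ≠ 0 := by rw [Matrix.det_fin_two_of]; norm_num
    set Ar : GL (Fin 2) ℂ := Matrix.GeneralLinearGroup.mkOfDetNeZero _ hdetA with hAr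
    set b : GL (Fin 2) ℂ := Matrix.GeneralLinearGroup.mkOfDetNeZero _ hdetb with hb
    have hAr_val : (Ar : Matrix (Fin 2) (Fin 2) ℂ) = !![(1 : ℂ), 0; r, 1] := by
      rw [hAr, Matrix.GeneralLinearGroup.val_mkOfDetNeZero]
    have hb_val : (b : Matrix (Fin 2) (Fin 2) ℂ) = !![(-1 : ℂ), r⁻¹; 0, 1] := by
      rw [hb, Matrix.GeneralLinearGroup.val_mkOfDetNeZero]
    have hb_upper : IsUpperTriangular b :=
      pnm_isUpperTriangular_of_apply_eq_zero (by rw [hb_val]; simp)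
    have hb_char : weightChar χ b = -1 := by
      rw [pnm_weightChar_fin_two, hb_val, hχ]
      simp
      norm_num
    have hmat : !![(-1 : ℂ), r⁻¹; 0, 1] * !![(1 : ℂ), 0; r, 1] = !![(1 : ℂ), 0; r, 1] * !![0, r⁻¹; r, 0] := by
      ext i j
      fin_cases i <;> fin_cases j <;> simp [Matrix.mul_apply, Fin.sum_univ_two, hr]
    have h := key b hb_upper Ar
    rw [hAr_val, hb_val, hb_char, hmat, stab _ _ (pnm_linSubst_antidiag r⁻¹ r (inv_mul_cancel₀ hr))] at h
    -- h : ψ A_r = -1 * ψ A_r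
    have : (2 : ℂ) * ψ !![1, 0; r, 1] = 0 := by linear_combination h
    simpa using this
  -- Step 4: every `A ∈ GL₂`
  apply pnm_mk_eq_zero_of_forall f 4
  intro A
  change ψ (A : Matrix (Fin 2) (Fin 2) ℂ) = 0
  by_cases h10 : (A : Matrix (Fin 2) (Fin 2) ℂ) 1 0 = 0
  · exact h2 A (pnm_isUpperTriangular_of_apply_eq_zero h10)
  by_cases h11 : (A : Matrix (Fin 2) (Fin 2) ℂ) 1 1 = 0
  · -- swap the columns: `A · W` is upper triangular and `W` stabilises `f`
    have hdetW : Matrix.det !![(0 : ℂ), 1; 1, 0] ≠ 0 := by rw [Matrix.det_fin_two_of]; norm_num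
    set W : GL (Fin 2) ℂ := Matrix.GeneralLinearGroup.mkOfDetNeZero _ hdetW with hW
    have hW_val : (W : Matrix (Fin 2) (Fin 2) ℂ) = !![(0 : ℂ), 1; 1, 0] := by
      rw [hW, Matrix.GeneralLinearGroup.val_mkOfDetNeZero]
    have hAW : IsUpperTriangular (A * W) := by
      apply pnm_isUpperTriangular_of_apply_eq_zero
      rw [Matrix.GeneralLinearGroup.coe_mul, hW_val, Matrix.eta_fin_two (A : Matrix (Fin 2) (Fin 2) ℂ),
        Matrix.mul_fin_two]
      simp [h11]
    have h := h2 (A * W) hAW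
    rw [Matrix.GeneralLinearGroup.coe_mul, hW_val, stab _ _ (pnm_linSubst_antidiag 1 1 (by norm_num))] at h
    exact h
  · -- `A = b · A_r` with `r = A₁₀ / A₁₁ ≠ 0` and `b` upper triangular
    have hr0 : (A : Matrix (Fin 2) (Fin 2) ℂ) 1 0 / (A : Matrix (Fin 2) (Fin 2) ℂ) 1 1 ≠ 0 :=
      div_ne_zero h10 h11
    have hdetA : (A : Matrix (Fin 2) (Fin 2) ℂ).det ≠ 0 := (Matrix.isUnits_det_units A).ne_zero
    have hdetA' : (A : Matrix (Fin 2) (Fin 2) ℂ) 0 0 * (A : Matrix (Fin 2) (Fin 2) ℂ) 1 1 -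
        (A : Matrix (Fin 2) (Fin 2) ℂ) 0 1 * (A : Matrix (Fin 2) (Fin 2) ℂ) 1 0 ≠ 0 := by
      rw [Matrix.eta_fin_two (A : Matrix (Fin 2) (Fin 2) ℂ), Matrix.det_fin_two_of] at hdetA
      exact hdetA
    have hdetb : Matrix.det !![(A : Matrix (Fin 2) (Fin 2) ℂ) 0 0 - (A : Matrix (Fin 2) (Fin 2) ℂ) 0 1 *
        ((A : Matrix (Fin 2) (Fin 2) ℂ) 1 0 / (A : Matrix (Fin 2) (Fin 2) ℂ) 1 1), (A : Matrix (Fin 2) (Fin 2) ℂ) 0 1;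
        0, (A : Matrix (Fin 2) (Fin 2) ℂ) 1 1] ≠ 0 := by
      rw [Matrix.det_fin_two_of]
      field_simp
      intro h
      apply hdetA'
      linear_combination h
    set b : GL (Fin 2) ℂ := Matrix.GeneralLinearGroup.mkOfDetNeZero _ hdetb with hb
    have hb_val : (b : Matrix (Fin 2) (Fin 2) ℂ) = !![(A : Matrix (Fin 2) (Fin 2) ℂ) 0 0 - (A : Matrix (Fin 2) (Fin 2) ℂ) 0 1 *
        ((A : Matrix (Fin 2) (Fin 2) ℂ) 1 0 / (A : Matrix (Fin 2) (Fin 2) ℂ) 1 1), (A : Matrix (Fin 2) (Fin 2) ℂ) 0 1;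
        0, (A : Matrix (Fin 2) (Fin 2) ℂ) 1 1] := by
      rw [hb, Matrix.GeneralLinearGroup.val_mkOfDetNeZero]
    have hb_upper : IsUpperTriangular b :=
      pnm_isUpperTriangular_of_apply_eq_zero (by rw [hb_val]; simp)
    have hdetAr : Matrix.det !![(1 : ℂ), 0; (A : Matrix (Fin 2) (Fin 2) ℂ) 1 0 / (A : Matrix (Fin 2) (Fin 2) ℂ) 1 1, 1] ≠ 0 := by
      rw [Matrix.det_fin_two_of]; norm_num
    set Ar : GL (Fin 2) ℂ := Matrix.GeneralLinearGroup.mkOfDetNeZero _ hdetAr with hAr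
    have hAr_val : (Ar : Matrix (Fin 2) (Fin 2) ℂ) =
        !![(1 : ℂ), 0; (A : Matrix (Fin 2) (Fin 2) ℂ) 1 0 / (A : Matrix (Fin 2) (Fin 2) ℂ) 1 1, 1] := by
      rw [hAr, Matrix.GeneralLinearGroup.val_mkOfDetNeZero]
    have hmat : !![(A : Matrix (Fin 2) (Fin 2) ℂ) 0 0 - (A : Matrix (Fin 2) (Fin 2) ℂ) 0 1 *
        ((A : Matrix (Fin 2) (Fin 2) ℂ) 1 0 / (A : Matrix (Fin 2) (Fin 2) ℂ) 1 1), (A : Matrix (Fin 2) (Fin 2) ℂ) 0 1;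
        0, (A : Matrix (Fin 2) (Fin 2) ℂ) 1 1] *
        !![(1 : ℂ), 0; (A : Matrix (Fin 2) (Fin 2) ℂ) 1 0 / (A : Matrix (Fin 2) (Fin 2) ℂ) 1 1, 1] =
          (A : Matrix (Fin 2) (Fin 2) ℂ) := by
      ext i j
      fin_cases i <;> fin_cases j <;> simp [Matrix.mul_apply, Fin.sum_univ_two]
      field_simp
    have h := key b hb_upper Ar
    rw [hAr_val, hb_val, hmat, h3 _ hr0] at h
    -- h : 0 = weightChar χ b * ψ A
    exact (mul_eq_zero.mp h.symm).resolve_left (weightChar_ne_zero χ hb_upper)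

end

end Summit.ValiantsHypothesis.ValiantsHypothesis.Theorems.ValuativeFlip
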